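import Summits.ResolutionOfSingularities.ResolutionOfSingularities.Theorems.WeightedInvariantIota3IsoSuccTopStratum
import Summits.ResolutionOfSingularities.ResolutionOfSingularities.Theorems.WeightedInvariantContactCylinderSuccessorSplit
import HarnessLib

/-!
# Point moves IX: the equimultiple locus of an order-stationary successor of a CURVE-locus start — closed point ∪ the primes off `V(t⁻¹)` over the
# curve's generic point (door `HypersurfaceCentreConstruction`, stmt-ResolutionOfSingularities-19897; stub `stub_keyRungGrHomLE_three`, residual
# (TIE-ON) of …KeyRungThreeOfDropPointSplit)

Topic: `Summits/ResolutionOfSingularities/ResolutionOfSingularities/Theorems`.  DEF-FREE.  Helper `--supports stmt-ResolutionOfSingularities-19897`.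

At a TIE start the equimultiple locus of `(S, f)` is a regular CURVE `V(P₀)` through the closed point (`ε = 0`, `dim S ⧸ P₀ = 1`).  Sequel of
…IsoSuccTopStratum (`mem_topStratum_iotaOrd_transform_iff`: equimultiple below an order-stationary successor = closed point ∪ primes off `V(t⁻¹)` whose
contraction lies in `Σ(S, f)`): when `Σ(S, f) = V(P₀)` with `dim S ⧸ P₀ ≤ 1`, "contraction in `Σ(S, f)`" is "contraction EQUAL TO `P₀`".

* `LocalGameEFTPointMove.comap_eq_of_tInv_not_mem_of_mem_topStratum` — `t⁻¹ ∉ 𝔮 ≤ 𝔫` (off-vertex), `𝔮 ∩ S ∈ Σ(S,f) = V(P₀)`, `dim S ⧸ P₀ ≤ 1`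
  ⟹ `𝔮 ∩ S = P₀` (it contains `P₀` and is not `𝔪`).
* **`LocalGameEFTPointMove.mem_topStratum_iotaOrd_transform_iff_of_curve`** — at an order-stationary successor `𝔫` (exceptional half given) of a
  start with `Σ(S, f) = V(P₀)`, `dim S ⧸ P₀ ≤ 1`: a prime `Q` of `B_𝔫` is equimultiple iff it is the closed point or (`t⁻¹ ∉ Q` and `Q ∩ S = P₀`),
  i.e. iff it is the closed point or a prime of the STRICT TRANSFORM of `V(P₀)` through `𝔫`.

[OURS · L1 W4.3 · audit glue; AI work, weaker than expert review; nothing here is a statement of the manuscript under review (Hironaka 2017,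
[claim: Hironaka2017, status: under-review]).]

## References

* J. Włodarczyk, *Functorial resolution by torus actions*, arXiv:2203.03090, Def. 2.3.5, §3.3 (strict transform). [Wlodarczyk2022]
* H. Matsumura, *Commutative Ring Theory*, CUP 1986, §5. [Matsumura1987]
-/

noncomputable section

open IsLocalRing Literature.AlgebraicGeometry.Resolution
open Summit.ResolutionOfSingularities.ResolutionOfSingularities.Cruxes.HypersurfaceCentreConstruction.LocalEngine

set_option linter.dupNamespace false -- mandated namespace of this single-conjunct summit

namespace Summit.ResolutionOfSingularities.ResolutionOfSingularities.Theorems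

namespace LocalGameEFTPointMove

variable {S : Type} [CommRing S] [IsLocalRing S] {d : ℕ} (u : Fin d → S) (w : Fin d → ℕ)
  (hu : Ideal.span (Set.range u) = maximalIdeal S)

include hu in
/-- **Over a curve locus a prime below a successor missing `t⁻¹` contracts ONTO the curve's generic point**: `t⁻¹ ∉ 𝔮 ≤ 𝔫`, `𝔫` off the vertex,
`𝔮 ∩ S ∈ Σ(S, f) = V(P₀)` with `dim S ⧸ P₀ ≤ 1` ⟹ `𝔮 ∩ S = P₀`. [OURS · L1 W4.3] [cite: Matsumura1987, §5] -/
theorem comap_eq_of_tInv_not_mem_of_mem_topStratum {f : S} (P₀ : Ideal S) [P₀.IsPrime] (hP1 : ringKrullDim (S ⧸ P₀) ≤ 1)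
    (hE : ContactCylinder.topStratum iotaOrd S f = {𝔭 | P₀ ≤ 𝔭.asIdeal})
    (𝔮 : Ideal (extReesAlgebra (weightedMonomialIdeal u w))) [𝔮.IsPrime] (hT : extReesAlgebra.tInv (weightedMonomialIdeal u w) ∉ 𝔮)
    {𝔫 : Ideal (extReesAlgebra (weightedMonomialIdeal u w))} (hle : 𝔮 ≤ 𝔫)
    (hV : ¬ extReesAlgebra.vertexIdeal (weightedMonomialIdeal u w) ≤ 𝔫)
    (hmem : (⟨𝔮.comap (algebraMap S (extReesAlgebra (weightedMonomialIdeal u w))), Ideal.IsPrime.comap _⟩ : PrimeSpectrum S) ∈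
      ContactCylinder.topStratum iotaOrd S f) :
    𝔮.comap (algebraMap S (extReesAlgebra (weightedMonomialIdeal u w))) = P₀ := by
  haveI : (𝔮.comap (algebraMap S (extReesAlgebra (weightedMonomialIdeal u w)))).IsPrime := Ideal.IsPrime.comap _
  rw [hE] at hmem
  rcases ContactCylinder.eq_or_eq_maximalIdeal_of_le_of_ringKrullDim_quotient_le_one P₀ hP1 _ hmem with h | h
  · exact h
  · exact absurd h (comap_ne_maximalIdeal_of_tInv_not_mem u w hu 𝔮 hT hle hV)

include hu in
/-- **THE EQUIMULTIPLE LOCUS AT AN ORDER-STATIONARY SUCCESSOR OF A CURVE-LOCUS START** (`Σ(S, f) = V(P₀)`, `dim S ⧸ P₀ ≤ 1`; the order of the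
transform `< ν` at every prime `t⁻¹ ∈ 𝔮 < 𝔫`): a prime `Q` of `B_𝔫` is equimultiple for `g/1` iff it is the closed point, or `t⁻¹ ∉ Q` and
`Q ∩ S = P₀` (a prime of the strict transform of `V(P₀)`). [OURS · L1 W4.3] [cite: Wlodarczyk2022, §3.3] -/
theorem mem_topStratum_iotaOrd_transform_iff_of_curve (𝔫 : Ideal (extReesAlgebra (weightedMonomialIdeal u w))) [𝔫.IsPrime]
    (hV : ¬ extReesAlgebra.vertexIdeal (weightedMonomialIdeal u w) ≤ 𝔫)
    {f : S} (P₀ : Ideal S) [P₀.IsPrime] (hP1 : ringKrullDim (S ⧸ P₀) ≤ 1)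
    (hE : ContactCylinder.topStratum iotaOrd S f = {𝔭 | P₀ ≤ 𝔭.asIdeal})
    {a : ℕ} {g : extReesAlgebra (weightedMonomialIdeal u w)}
    (hfg : algebraMap S (extReesAlgebra (weightedMonomialIdeal u w)) f = extReesAlgebra.tInv (weightedMonomialIdeal u w) ^ a * g)
    {ν : ℕ} (hνS : iotaOrd S f = ν)
    (hstat : iotaOrd (Localization.AtPrime 𝔫) (algebraMap _ (Localization.AtPrime 𝔫) g) = ν)
    (hbelowT : ∀ (𝔮 : Ideal (extReesAlgebra (weightedMonomialIdeal u w))) [𝔮.IsPrime],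
      extReesAlgebra.tInv (weightedMonomialIdeal u w) ∈ 𝔮 → 𝔮 < 𝔫 →
      iotaOrd (Localization.AtPrime 𝔮) (algebraMap _ (Localization.AtPrime 𝔮) g) < ν)
    (Q : PrimeSpectrum (Localization.AtPrime 𝔫)) :
    Q ∈ ContactCylinder.topStratum iotaOrd (Localization.AtPrime 𝔫) (algebraMap _ (Localization.AtPrime 𝔫) g) ↔
      Q.asIdeal = maximalIdeal (Localization.AtPrime 𝔫) ∨
        (algebraMap _ (Localization.AtPrime 𝔫) (extReesAlgebra.tInv (weightedMonomialIdeal u w)) ∉ Q.asIdeal ∧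
          (Q.asIdeal.comap (algebraMap (extReesAlgebra (weightedMonomialIdeal u w)) (Localization.AtPrime 𝔫))).comap
              (algebraMap S (extReesAlgebra (weightedMonomialIdeal u w))) = P₀) := by
  rw [mem_topStratum_iotaOrd_transform_iff u w 𝔫 hfg hνS hstat hbelowT Q]
  set 𝔮 : Ideal (extReesAlgebra (weightedMonomialIdeal u w)) :=
    Q.asIdeal.comap (algebraMap (extReesAlgebra (weightedMonomialIdeal u w)) (Localization.AtPrime 𝔫)) with h𝔮def
  haveI : 𝔮.IsPrime := Ideal.IsPrime.comap _
  have hle : 𝔮 ≤ 𝔫 := Iota3.comap_le_of_isLocalization_atPrime 𝔫 (Localization.AtPrime 𝔫) Q.asIdeal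
  have hTQ : algebraMap _ (Localization.AtPrime 𝔫) (extReesAlgebra.tInv (weightedMonomialIdeal u w)) ∈ Q.asIdeal ↔
      extReesAlgebra.tInv (weightedMonomialIdeal u w) ∈ 𝔮 := Iff.rfl
  refine or_congr_right (and_congr_right fun hT => ?_)
  have hT' : extReesAlgebra.tInv (weightedMonomialIdeal u w) ∉ 𝔮 := fun h => hT (hTQ.mpr h)
  constructor
  · exact comap_eq_of_tInv_not_mem_of_mem_topStratum u w hu P₀ hP1 hE 𝔮 hT' hle hV
  · intro h
    rw [hE]
    exact h.ge

end LocalGameEFTPointMove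

end Summit.ResolutionOfSingularities.ResolutionOfSingularities.Theorems

end
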